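import Summits.HubbardSuperconductivity.HubbardSuperconductivity.Theorems.AnisotropyChordTransferFibre3RingResolvent
import Summits.HubbardSuperconductivity.HubbardSuperconductivity.Theorems.AnisotropyChordTransferFibre3GreenZero

/-!
# Route `AnisotropyChord` / H0 rotor rung: PartN35 (Level-2 toolkit) — the exact O(L) ROW FORMULA `GRowFormula` PROVED

PartN35 = `…Fibre3Level2Toolkit` (theory seat `hubbard-h0-rotor-theory-1`, memo 21 §310(a); port by `hubbard-h0-rotor-p2`):
**`gRowFormula_holds : GRowFormula L`** — for `0 < λ < 2ε₁` and every site `(x, y)`,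
`V·G_λ(x,y) = −L cos((L/2−y)α₀)/(2 sin α₀ sin(Lα₀/2)) + 1/(2(1 − cos α₀))
            + Σ_{m≠0} cos(2π m x/L) · L cosh((L/2−y)μ_m)/(2 sinh μ_m sinh(Lμ_m/2))`.

Proof: `V·G(x,y) = Σ_{(m,n)} g(m,n) Re(e(xm) e(yn))` row by row.  In row `m` the denominator is
`2ε(m,n) − λ = 2(c_m − cos θ_n)`, `c_m = 2 − cos θ_m − λ/2`; the sine part of `Re(e(xm)e(yn))` sums to zero (`n ↦ −n`,
`sum_im_row_zero`) and the cosine part is a ring resolvent (`row_eval`): for `m ≠ 0`, `c_m = cosh μ_m` with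
`μ_m = arcosh c_m > 0` (`1 − cos θ_m ≥ ε₁ > λ/2`) and `ringResolventSum_holds` applies; for `m = 0`, `c_0 = 1 − λ/2 = cos α₀`
with `α₀ = arccos(1 − λ/2) ∈ (0, 2π/L)` (so `sin α₀ ≠ 0`, `sin(Lα₀/2) ≠ 0`, `cos α₀ ∉ {cos θ_n}`) and
`ringResolventSumTrig_holds` applies, the removed zero mode contributing `+1/(2(1 − cos α₀))`.

Nothing here proves superconductivity in the Hubbard model; these are helper lemmas of ONE conditional reduction
(rung stmt-HubbardSuperconductivity-19089).  Prover seat `hubbard-h0-rotor-p3` g0; `--supports stmt-HubbardSuperconductivity-19089`.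
-/

set_option linter.dupNamespace false
set_option autoImplicit false

noncomputable section

open scoped BigOperators
open Complex

namespace Summit.HubbardSuperconductivity.HubbardSuperconductivity.Theorems.AnisotropyChord.Transfer.Fibre3

variable (L : ℕ) [NeZero L]

/-! ## Row sums -/

/-- `cos θ_{−n} = cos θ_n`. [folklore] -/
theorem cos_val_neg (n : ZMod L) :
    Real.cos (2 * Real.pi * (-n : ZMod L).val / L) = Real.cos (2 * Real.pi * n.val / L) := by
  rw [← phZ_re_eq_cos, ← phZ_re_eq_cos, ← conj_phZ, Complex.conj_re]

/-- **the sine row sum vanishes** (odd under `n ↦ −n`). [folklore] -/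
theorem sum_im_row_zero (c : ℝ) (y : ZMod L) :
    ∑ n : ZMod L, (phZ L (y * n)).im / (c - Real.cos (2 * Real.pi * n.val / L)) = 0 := by
  have him : ∀ n : ZMod L, (phZ L (y * -n)).im = -(phZ L (y * n)).im := by
    intro n; rw [mul_neg, ← conj_phZ, Complex.conj_im]
  have h := Fintype.sum_equiv (Equiv.neg (ZMod L))
    (fun n => (phZ L (y * -n)).im / (c - Real.cos (2 * Real.pi * (-n : ZMod L).val / L)))
    (fun n => (phZ L (y * n)).im / (c - Real.cos (2 * Real.pi * n.val / L))) (fun n => rfl)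
  simp only [him, cos_val_neg, neg_div, Finset.sum_neg_distrib] at h
  linarith

/-- **row evaluation:** `Σ_n Re(e(xm)e(yn))/(2(c − cos θ_n)) = cos(2π m x/L)·R/2` where `R` is the ring resolvent
`Σ_n cos(2π n y/L)/(c − cos θ_n)`. [folklore] -/
theorem row_eval (c : ℝ) (m x y : ZMod L) (R : ℝ)
    (hR : ∑ n : ZMod L, Real.cos (2 * Real.pi * n.val * y.val / L) / (c - Real.cos (2 * Real.pi * n.val / L)) = R) :
    ∑ n : ZMod L, (phZ L (x * m) * phZ L (y * n)).re / (2 * (c - Real.cos (2 * Real.pi * n.val / L)))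
      = Real.cos (2 * Real.pi * m.val * x.val / L) * R / 2 := by
  have hcos : (phZ L (x * m)).re = Real.cos (2 * Real.pi * m.val * x.val / L) := by
    rw [mul_comm x m, phZ_mul_re_eq_cos]
  have hpt : ∀ n : ZMod L, (phZ L (x * m) * phZ L (y * n)).re / (2 * (c - Real.cos (2 * Real.pi * n.val / L)))
      = Real.cos (2 * Real.pi * m.val * x.val / L) / 2
          * (Real.cos (2 * Real.pi * n.val * y.val / L) / (c - Real.cos (2 * Real.pi * n.val / L)))
        - (phZ L (x * m)).im / 2 * ((phZ L (y * n)).im / (c - Real.cos (2 * Real.pi * n.val / L))) := by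
    intro n
    rw [Complex.mul_re, hcos, mul_comm y n, phZ_mul_re_eq_cos, mul_comm n y, ← div_div]
    ring
  rw [Finset.sum_congr rfl fun n _ => hpt n, Finset.sum_sub_distrib, ← Finset.mul_sum, ← Finset.mul_sum, hR,
    sum_im_row_zero]
  ring

/-! ## `GRowFormula` -/

/-- ★ **`GRowFormula L` holds.** [folklore] -/
theorem gRowFormula_holds : GRowFormula L := by
  classical
  intro lam2 hl0 hl2 r
  -- `L ≥ 2` (for `L = 1`, `ε₁ = 0` contradicts `0 < λ < 2ε₁`)
  have hL2 : 2 ≤ L := by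
    by_contra h
    have hL1 : (L : ℝ) = 1 := by have := NeZero.ne L; exact_mod_cast (show L = 1 by omega)
    have : eps1 L = 0 := by unfold eps1; rw [hL1, div_one, Real.cos_two_pi]; ring
    linarith
  have hLpos : (0 : ℝ) < L := by exact_mod_cast (show 0 < L by omega)
  have hV : ((L : ℝ) ^ 2) ≠ 0 := by positivity
  have heps2 : eps1 L ≤ 2 := by
    unfold eps1; have := Real.neg_one_le_cos (2 * Real.pi / L); linarith
  -- 1D gap: `1 − cos θ_n ≥ ε₁` for `n ≠ 0`
  have gap1 : ∀ n : ZMod L, n ≠ 0 → eps1 L ≤ 1 - Real.cos (2 * Real.pi * n.val / L) := by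
    intro n hn
    have hk : ((n, (0 : ZMod L)) : Tor L) ≠ 0 := fun h => hn (congrArg Prod.fst h)
    have h := eps1_le_epsT L hL2 hk
    unfold epsT at h
    simp only [ZMod.val_zero, Nat.cast_zero, mul_zero, zero_div, Real.cos_zero] at h
    linarith
  -- (0) expand `V·G` as a double sum over rows
  unfold Gres
  rw [mul_div_cancel₀ _ hV, Fintype.sum_prod_type, ← Finset.add_sum_erase _ _ (Finset.mem_univ (0 : ZMod L))]
  obtain ⟨x, y⟩ := r
  simp only
  -- (1) the rows `m ≠ 0`
  have hrow : ∀ m ∈ (Finset.univ : Finset (ZMod L)).erase 0,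
      ∑ n : ZMod L, gres L lam2 (m, n) * (phase L (m, n) (x, y)).re
        = Real.cos (2 * Real.pi * m.val * x.val / L)
          * (L * Real.cosh (((L : ℝ) / 2 - y.val) * muRow L lam2 m)
              / (2 * Real.sinh (muRow L lam2 m) * Real.sinh (L * muRow L lam2 m / 2))) := by
    intro m hm
    have hm0 : m ≠ 0 := Finset.ne_of_mem_erase hm
    set c : ℝ := 2 - Real.cos (2 * Real.pi * m.val / L) - lam2 / 2 with hc
    have hc1 : 1 < c := by have := gap1 m hm0; rw [hc]; linarith
    have hμ : 0 < muRow L lam2 m := Real.arcosh_pos hc1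
    have hcosh : Real.cosh (muRow L lam2 m) = c := Real.cosh_arcosh hc1.le
    have hR := ringResolventSum_holds L (muRow L lam2 m) hμ y
    rw [hcosh] at hR
    have hpt : ∀ n : ZMod L, gres L lam2 (m, n) * (phase L (m, n) (x, y)).re
        = (phZ L (x * m) * phZ L (y * n)).re / (2 * (c - Real.cos (2 * Real.pi * n.val / L))) := by
      intro n
      have hk : ((m, n) : Tor L) ≠ 0 := fun h => hm0 (congrArg Prod.fst h)
      unfold gres
      rw [if_neg hk, phase_eq_mul]
      unfold epsT
      simp only [hc]
      ring
    rw [Finset.sum_congr rfl fun n _ => hpt n, row_eval L c m x y _ hR]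
    ring
  rw [Finset.sum_congr rfl hrow]
  -- (2) the row `m = 0`
  have ht1 : -1 ≤ 1 - lam2 / 2 := by linarith
  have ht2 : 1 - lam2 / 2 ≤ 1 := by linarith
  have hcosα : Real.cos (alpha0 lam2) = 1 - lam2 / 2 := by unfold alpha0; exact Real.cos_arccos ht1 ht2
  have hαpos : 0 < alpha0 lam2 := by unfold alpha0; exact Real.arccos_pos.mpr (by linarith)
  have hαlt : alpha0 lam2 < 2 * Real.pi / L := by
    have hθ0 : 0 ≤ 2 * Real.pi / L := by positivity
    have hθπ : 2 * Real.pi / L ≤ Real.pi := by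
      rw [div_le_iff₀ hLpos]
      have : (2 : ℝ) ≤ L := by exact_mod_cast hL2
      nlinarith [Real.pi_pos]
    have hlt : Real.cos (2 * Real.pi / L) < 1 - lam2 / 2 := by
      have : eps1 L = 1 - Real.cos (2 * Real.pi / L) := rfl
      linarith
    unfold alpha0
    calc Real.arccos (1 - lam2 / 2) < Real.arccos (Real.cos (2 * Real.pi / L)) :=
          Real.arccos_lt_arccos (Real.neg_one_le_cos _) hlt ht2
      _ = 2 * Real.pi / L := Real.arccos_cos hθ0 hθπ
  have hsinα : Real.sin (alpha0 lam2) ≠ 0 := by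
    have hαπ : alpha0 lam2 < Real.pi := by unfold alpha0; exact Real.arccos_lt_pi.mpr (by linarith)
    exact (Real.sin_pos_of_pos_of_lt_pi hαpos hαπ).ne'
  have hsinL : Real.sin (L * alpha0 lam2 / 2) ≠ 0 := by
    have h1 : 0 < L * alpha0 lam2 / 2 := by positivity
    have h2 : L * alpha0 lam2 / 2 < Real.pi := by
      have := mul_lt_mul_of_pos_left hαlt hLpos
      rw [mul_div_cancel₀ _ hLpos.ne'] at this
      linarith
    exact (Real.sin_pos_of_pos_of_lt_pi h1 h2).ne'
  have hres : ∀ n : ZMod L, Real.cos (alpha0 lam2) ≠ Real.cos (2 * Real.pi * n.val / L) := by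
    intro n
    rw [hcosα]
    by_cases hn : n = 0
    · rw [hn, ZMod.val_zero, Nat.cast_zero, mul_zero, zero_div, Real.cos_zero]; linarith
    · have := gap1 n hn; linarith
  have hR0 := ringResolventSumTrig_holds L (alpha0 lam2) hsinα hsinL hres y
  rw [hcosα] at hR0
  have hrow0 : ∑ n : ZMod L, gres L lam2 (0, n) * (phase L (0, n) (x, y)).re
      = -(L * Real.cos (((L : ℝ) / 2 - y.val) * alpha0 lam2)
            / (2 * Real.sin (alpha0 lam2) * Real.sin (L * alpha0 lam2 / 2)))
        + 1 / (2 * (1 - Real.cos (alpha0 lam2))) := by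
    have hpt : ∀ n : ZMod L, gres L lam2 (0, n) * (phase L (0, n) (x, y)).re
        = if n = 0 then 0
          else (phZ L (x * 0) * phZ L (y * n)).re / (2 * ((1 - lam2 / 2) - Real.cos (2 * Real.pi * n.val / L))) := by
      intro n
      unfold gres
      by_cases hn : n = 0
      · rw [if_pos (by rw [hn]; rfl), if_pos hn, zero_mul]
      · have hk : (((0 : ZMod L), n) : Tor L) ≠ 0 := fun h => hn (congrArg Prod.snd h)
        rw [if_neg hk, if_neg hn, phase_eq_mul]
        unfold epsT
        simp only [ZMod.val_zero, Nat.cast_zero, mul_zero, zero_div, Real.cos_zero]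
        ring
    rw [Finset.sum_congr rfl fun n _ => hpt n, Finset.sum_ite, Finset.sum_const_zero, zero_add,
      Finset.filter_ne' Finset.univ (0 : ZMod L), Finset.sum_erase_eq_sub (Finset.mem_univ _),
      row_eval L (1 - lam2 / 2) 0 x y _ hR0, hcosα]
    simp only [ZMod.val_zero, Nat.cast_zero, mul_zero, zero_mul, zero_div, Real.cos_zero, phZ_zero, one_mul,
      Complex.one_re]
    have h1 : (1 : ℝ) - lam2 / 2 - 1 ≠ 0 := by
      intro h; linarith
    have h2 : (1 : ℝ) - (1 - lam2 / 2) ≠ 0 := by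
      intro h; linarith
    field_simp
    ring
  rw [hrow0]

end Summit.HubbardSuperconductivity.HubbardSuperconductivity.Theorems.AnisotropyChord.Transfer.Fibre3

end
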